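import Summits.Ventures.HodgeRepro2.T5SchurMathlib

/-!
# The dimension of the invariants is the average of the character: `dim V^G = ∫ χ_π dμ`

Blind cell `pub-hodge-repro2`, seat p1 (gen 12), Tier-5 kernel support for the representation-theoretic
sentences of `route/T5-SUPPORT-p1.md` §S4.7 (the «multiplicity of the trivial K-type» read off from
characters; compare p8's finite-group trace formula for `dim V^K`).

For a continuous finite-dimensional representation `π` of a compact group `G` with left-invariant
probability measure `μ`, the **averaging operator** `avgOp μ π := ∫ π g dμ` (a Bochner integral in
`V →L[ℂ] V`) is a projection of `V` onto the invariants `(toRep π).invariants = {v | ∀ g, π g v = v}`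
(Mathlib `Representation.invariants`): its values are invariant by left invariance of `μ`, and it fixes
invariant vectors because `μ` is a probability measure.  Its trace is `∫ tr π(g) dμ = ∫ χ_π dμ`
(the trace is a continuous linear functional on `V →L[ℂ] V`, `T5SchurOrthogonality.traceCLM`), and the
trace of a projection is the dimension of its range (Mathlib `LinearMap.IsProj.trace`).  Hence

  **`finrank_invariants_eq_integral_character`** : `finrank ℂ V^G = ∫ χ_π dμ`,

with the `_haar` form against the normalised Haar measure.  No unitarity is assumed.  Print:
Goodman–Wallach GTM 255 §4.3.2 (finite groups: Lemma 4.3.3 / the projection onto invariants) and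
§7.3.4 p. 360 (compact groups, «integration relative to the normalized invariant measure»).  Honest
scope (unchanged): compact groups, finite-dimensional representations; nothing about U(1,1), π₃⁺ or (N).
-/

namespace Summit.Ventures.HodgeRepro2.T5InvariantsDimension

open MeasureTheory T5SchurOrthogonality T5SchurMathlib

variable {G : Type*} [Group G] [TopologicalSpace G] [IsTopologicalGroup G]
  [MeasurableSpace G] [BorelSpace G] [CompactSpace G]
variable {V : Type*} [NormedAddCommGroup V] [InnerProductSpace ℂ V] [FiniteDimensional ℂ V]
variable (μ : Measure G) [IsProbabilityMeasure μ] [μ.IsMulLeftInvariant]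
variable (π : G →* V →L[ℂ] V)

omit [IsTopologicalGroup G] [μ.IsMulLeftInvariant] [FiniteDimensional ℂ V] in
/-- A continuous representation is integrable on the compact group (finite measure). -/
theorem integrable_rep (hπ : Continuous π) : Integrable (fun g => π g) μ :=
  hπ.integrable_of_hasCompactSupport (HasCompactSupport.of_compactSpace _)

omit [IsTopologicalGroup G] [μ.IsMulLeftInvariant] [FiniteDimensional ℂ V] in
/-- `g ↦ π g v` is integrable. -/
theorem integrable_rep_apply (hπ : Continuous π) (v : V) : Integrable (fun g => π g v) μ :=
  (ContinuousLinearMap.apply ℂ V v).integrable_comp (integrable_rep μ π hπ)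

/-- The **averaging operator** `∫ π g dμ` (Bochner integral in `V →L[ℂ] V`). -/
noncomputable def avgOp : V →L[ℂ] V := ∫ g, π g ∂μ

omit [IsTopologicalGroup G] [μ.IsMulLeftInvariant] [FiniteDimensional ℂ V] in
/-- The averaging operator applied to `v` is `∫ π g v dμ`. -/
theorem avgOp_apply (hπ : Continuous π) (v : V) : avgOp μ π v = ∫ g, π g v ∂μ :=
  ContinuousLinearMap.integral_apply (integrable_rep μ π hπ) v

/-- The values of the averaging operator are invariant (left invariance of `μ`). -/
theorem avgOp_apply_mem_invariants (hπ : Continuous π) (v : V) :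
    avgOp μ π v ∈ (toRep π).invariants := by
  haveI : CompleteSpace V := FiniteDimensional.complete ℂ V
  rw [Representation.mem_invariants]
  intro h
  rw [toRep_apply, avgOp_apply μ π hπ,
    ← ContinuousLinearMap.integral_comp_comm _ (integrable_rep_apply μ π hπ v)]
  have : (fun g => π h (π g v)) = fun g => π (h * g) v := by
    funext g
    rw [map_mul, mul_apply_eq_comp]
  rw [this]
  exact integral_mul_left_eq_self (fun g => π g v) h

omit [IsTopologicalGroup G] [μ.IsMulLeftInvariant] in
/-- The averaging operator fixes invariant vectors (`μ` is a probability measure). -/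
theorem avgOp_apply_of_mem_invariants (hπ : Continuous π) {v : V}
    (hv : v ∈ (toRep π).invariants) : avgOp μ π v = v := by
  rw [avgOp_apply μ π hπ]
  have : (fun g => π g v) = fun _ => v := funext fun g => (Representation.mem_invariants _ _).mp hv g
  rw [this, integral_const, probReal_univ, one_smul]

/-- The averaging operator is a projection onto the invariants. -/
theorem isProj_avgOp (hπ : Continuous π) :
    LinearMap.IsProj (toRep π).invariants (avgOp μ π : V →ₗ[ℂ] V) :=
  ⟨avgOp_apply_mem_invariants μ π hπ, fun _ hv => avgOp_apply_of_mem_invariants μ π hπ hv⟩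

omit [IsTopologicalGroup G] [μ.IsMulLeftInvariant] in
/-- The trace of the averaging operator is the average of the character. -/
theorem trace_avgOp (hπ : Continuous π) :
    LinearMap.trace ℂ V (avgOp μ π : V →ₗ[ℂ] V) = ∫ g, character π g ∂μ := by
  haveI : CompleteSpace (V →L[ℂ] V) := FiniteDimensional.complete ℂ _
  rw [← traceCLM_apply, avgOp, ← ContinuousLinearMap.integral_comp_comm _ (integrable_rep μ π hπ)]
  simp only [traceCLM_apply]
  rfl

/-- **The dimension of the invariants is the average of the character**:
`finrank ℂ V^G = ∫ χ_π dμ` for every continuous finite-dimensional representation of a compact group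
(no unitarity). -/
theorem finrank_invariants_eq_integral_character (hπ : Continuous π) :
    (Module.finrank ℂ (toRep π).invariants : ℂ) = ∫ g, character π g ∂μ := by
  rw [← trace_avgOp μ π hπ, (isProj_avgOp μ π hπ).trace]

/-- The same against the normalised Haar measure of a compact Hausdorff group. -/
theorem finrank_invariants_eq_integral_character_haar [T2Space G] (hπ : Continuous π) :
    (Module.finrank ℂ (toRep π).invariants : ℂ) = ∫ g, character π g ∂(haarProb G) :=
  finrank_invariants_eq_integral_character (haarProb G) π hπ

/-- A representation without non-zero invariants has character of mean zero, and conversely. -/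
theorem invariants_eq_bot_iff (hπ : Continuous π) :
    (toRep π).invariants = ⊥ ↔ ∫ g, character π g ∂μ = 0 := by
  rw [← finrank_invariants_eq_integral_character μ π hπ, Submodule.finrank_eq_zero.symm]
  exact_mod_cast Iff.rfl

end Summit.Ventures.HodgeRepro2.T5InvariantsDimension
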